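import Mathlib.Analysis.Calculus.IteratedDeriv.Defs
import Mathlib.Algebra.Order.ToIntervalMod
import Literature.MathematicalPhysics.QuantumLattice.HubbardEffectiveAction
import Literature.MathematicalPhysics.QuantumLattice.GrassmannKernels
import Literature.MathematicalPhysics.QuantumLattice.HubbardScaleData
import Literature.MathematicalPhysics.QuantumLattice.AnisotropicSectors
import Literature.MathematicalPhysics.QuantumLattice.HubbardFermiRadius
import HarnessLib

/-!
# The scale report of the seeded Hubbard torus: the normal-form predicate binding a scale datum to `hubbardEffectiveAction`

Topic `Literature/MathematicalPhysics/QuantumLattice`; definition request `defn-hubbardScaleReport`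
(route HubbardSuperconductivity/AposterioriCapRg; it types the cruxes `SeededBrokenRegimeBoseFermi`
= stmt-13883 and `AposterioriOrderCriterionR` = stmt-13884, and answers the refuters' finding F4 on
stmt-1381 that "the report must be ONE defined normal form of `hubbardEffectiveAction`"; it is the
object named in `HubbardScaleData.lean`, § "NOT here").

## What this is

`HubbardScaleData.lean` fixed the certificate side of the route's a-posteriori criterion — a scale
datum `D` (scale `Λ₀`, `N_p` patches, nodal set, rational enclosures) is certified against a MODEL
REPORT `R : HubbardScaleData.Report D.numPatches = ℕ → ℝ → Set (Parameters D.numPatches)`,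
"for each volume `L` and inverse temperature `β` the parameter tuples
`p = (Δ on the patches, ρ_s, κ, v_F, v_Δ, η, m₀)` realised by the model's effective action at scale
`Λ₀`".  This file defines that report for the seeded grand-canonical Hubbard torus,

  `hubbardScaleReport U μ D h : HubbardScaleData.Report D.numPatches`,

from the Wilsonian effective action `𝒢 = hubbardEffectiveAction L M β U μ h Λ₀` (Salmhofer 1998/1999,
`HubbardEffectiveAction.lean`) as ONE predicate `IsRealisedAt L M β U μ h Λ₀ Np nodal p` ("the
effective action at scale `Λ₀` has the phase + quasiparticle form with parameters `p`"), taken in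
the temporal-continuum upper limit `M → ∞`.  Everything is a function of `(U, μ, h, L, β, Λ₀)` and of
the patch number and nodal set of `D` — never of `D`'s enclosures (`hubbardScaleReport_eq`).

## The predicate (items (i)–(vi) of the request)

`IsRealisedAt … p` holds iff `β > 0` and there are **normal-form data** `q : HubbardNormalForm L Np`
— static real functions on the torus momenta: a normal shift `n`, an anomalous self-energy `a`, a
field renormalisation `z`, all EVEN under `k⃗ ↦ -k⃗` (site-inversion covariance, singlet pairing),
plus seven pin constants per patch — such that, with the gap function `Δ = h φ_d + a` and the
quadratic quasiparticle form
`𝒬(q) = ε Σ_k [(n - iω z)(ψ⁺_{k↑}ψ⁻_{k↑} + ψ⁺_{k↓}ψ⁻_{k↓}) + a (ψ⁺_{k↑}ψ⁺_{-k↓} + ψ⁻_{-k↓}ψ⁻_{k↑})]`,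
`ε = (βL²)⁻¹` (the monomials and the normalisation of the free seeded action of `hubbardCovariance`,
whose Nambu matrix is `-iω + [[ξ, hφ_d],[hφ_d, -ξ]]`; deep below scale the quadratic form of the
remaining fields is thus `ε[-iω(1+z) + (ξ+n)τ₃ + Δ τ₁]`):

* (i) **patches**: `N_p` equal angular sectors of the polar angle of the centred momentum, centred
  at `2πi/N_p` (`InPatch`; the sectors of Feldman–Knörrer–Trubowitz / BGM 2006 §2.5 with an arbitrary
  count; for `8 ∣ N_p` axes and diagonals are patch centres), intersected with the spatial shell
  `|ξ_μ| < Λ₀` (`InShell`) — the **patch-shell** `S_i` (`patchShell`);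
* (iii) **gaps**: `p.gap i` reports `Δ` on `S_i` in the MIN-MODULUS sense (`GapCondition`): a value
  of `Δ` on `S_i` of least modulus (`0` if `S_i = ∅`), and on the patches NOT declared nodal `Δ`
  has a constant sign on `S_i` (`SignCondition`) — so the datum's threshold `|D.gap i| ≥ c Λ₀`
  certifies `|Δ| ≥ c Λ₀` on the WHOLE non-nodal patch-shell (`GapCondition.abs_le_abs`), while the
  single real number of `Parameters.gap` is kept;
* (iii) **nodal cones**: on every patch the datum declares nodal the data are PINNED
  (`NodalCondition`): `z ≡ z_i`, `Δ = v_a t + d₃ t³`, `ξ + n = s + (1+r)ξ + c₂t² + c₄t⁴` in the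
  tangential coordinate `t` from the free Fermi point `κ_i` on the patch's central ray
  (`nodePoint`, `tangentialCoord`; odd gap / even band profile = the mirror symmetry of a node on a
  diagonal), and the reported velocities are the cone's: `v_F = (1+r)|∇ε(κ_i)|/(1+z)`,
  `v_Δ = |v_a|/(1+z)` (Xiang–Wu 2022 §7.3: the d-wave quasiparticle dispersion at a node is fixed by
  `v_F` along and the gap slope `v_Δ` across the node); a dishonest nodal set cannot be pinned with
  a small remainder (the design note of `HubbardScaleData`);
* (ii), (v) **response coefficients**: `p.stiffness`, `p.compressibility`, `p.meanFieldDensity` ARE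
  `ρ_s = ∂²_a f_MF`, `κ = -∂²_{μ'} f_MF`, `m₀ = -½ ∂_{h'} f_MF` at `(a, μ', h') = (0, μ, h)`
  (`scaleStiffness`, `scaleCompressibility`, `scaleMeanFieldDensity`), derivatives of the
  **scale-`Λ₀` mean-field free energy per site** `f_MF(a, μ', h') = -(βL²)⁻¹[log N + log|Z^{>}| +
  log|∫dμ_{C^{≤}} e^{-𝒢₂}|]` (`mfFreeEnergy`): the exact grand potential
  `-(βL²)⁻¹ log(N · Z^{>} · ∫ dμ_{C^{≤}} e^{-𝒢})` (free determinant × above-scale partition function ×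
  below-scale integral; Salmhofer 1999 (2.105), (4.85)) with the below-scale integral in the
  QUADRATIC truncation `𝒢 ↦ 𝒢₂` (`quadraticPart`), for the DEFORMED model — uniform vector potential
  `a` on the `x`-bonds in the kinetic term only (the seed pins the pair phase: the London /
  helicity-modulus set-up; superfluid weight as static current response, Xiang–Wu 2022 §9.2,
  Scalapino–White–Zhang 1993; Fisher–Barber–Jasnow's helicity modulus is `ρ_s/4` in the pair-phase
  gradient `2a`), chemical potential `μ'`, seed `h'` — with the scale decomposition FROZEN at the
  reference `(μ, Λ₀)` (`deformedCovAbove`), so that these are response coefficients at one scale;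
  `m₀` is `Re⟨Δ_d⟩/L²` of the truncated model, the normalisation of `dWaveSourceDensity`
  (Koma–Tasaki 1994 §1), which is what the criterion compares with `dWaveOrderParameter`;
* (iv) **remainder**: `scaledRemainderNorm … q ≤ p.remainderNorm`, where the remainder is
  `R = 𝒢 - 𝒬(q) - 𝒦(𝒢)` and `𝒦(𝒢)` (`cooperKept`) is the KEPT quartic term: the `B₁g` spin-singlet
  Cooper-channel part of `𝒢₄` among below-scale legs (at each pair label the rank-one projection of
  the reduced singlet Cooper vertex onto the form factor `½(φ_d(k⃗) + φ_d(k⃗'))`, `cooperCoefficient`)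
  — the pair-fluctuation (phase and amplitude) exchange, the purely fermionic stand-in for
  `S_phase + S_mix` ("WITHOUT an explicit Hubbard–Stratonovich field", as requested).  The norm is
  `Σ_m Λ₀^{-(2m-3)} ‖R_m‖_m`: Salmhofer's `L¹–L^∞` norms (Salmhofer 1998 §4.1) of Salmhofer's
  kernels `weightedKernel ε R m` (`GrassmannKernels.lean`), in momentum space, with a WEIGHT ON EVERY
  LEG (`legKernelNorm`): for the quadratic remainder the below-scale weight `√(1 - w_{Λ₀})`
  (`shellLegWeight`), for the other degrees `√((1 - w_{Λ₀}) Λ₀/max(Λ₀, E_q))` (`energyLegWeight`, the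
  relative size at scale `Λ₀` of a below-scale propagator of a leg the normal form declares to have
  static energy `E_q = √((ξ+n)² + Δ²)`), each degree divided by its natural size at scale `Λ₀`
  (`Λ₀^{2m-3}`: `Λ₀` for the quadratic part, `Λ₀⁵` for a quartic vertex marginal in nodal power
  counting, …), so that relevant unabsorbed terms blow up, marginal ones are `O(1)` and irrelevant
  ones vanish as `Λ₀ ↓ 0`;
* (vi) **`M → ∞` inside**: `hubbardScaleReportAt U μ h Λ₀ Np nodal L β` is the Kuratowski upper limit
  in `M` of the realised sets (for every `δ > 0`, frequently in `M`, a `δ`-close realised tuple),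
  and `hubbardScaleReport U μ D h = hubbardScaleReportAt U μ h D.scale D.numPatches D.nodal`;
  `L = 0` and `β ≤ 0` give `∅`.

## API (all proved)

`deformedNambuPropagator_zero`, `deformedCovariance_zero`, `deformedCovAbove_zero`,
`deformedEffAction_zero` (at zero deformation everything is the tree's own covariance / effective
action: the responses are derivatives of functionals of `hubbardEffectiveAction` itself);
`legKernelNorm_nonneg`, `legKernelNorm_one` (`= kernelNorm`); `scaledRemainderNorm_nonneg`;
`effAction_zero_interaction`, `hubbardEffectiveAction_zero_coupling`, `remainderOf_free`,
`scaledRemainderNorm_free` and **`isRealisedAt_free_noPatch`** (non-vacuity of the predicate: at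
`U = 0` the free seeded torus realises its mean-field responses with zero remainder);
`GapCondition.abs_le_abs/.eq_zero`, `IsRealisedAt.exists_normalForm`,
`IsRealisedAt.remainderNorm_nonneg`; `hubbardScaleReport_eq`, `hubbardScaleReport_congr` (dependence
on `D` through `(scale, numPatches, nodal)` only), `mem_hubbardScaleReportAt_iff`,
`mem_hubbardScaleReportAt_of_eventually`, `remainderNorm_nonneg_of_mem`, and the two answers to the
refuters' probes W.lean P2/P4 on stmt-1381: **`hubbardScaleReport_ne_univ`** (the report is not the
universal report) and `not_isCertifiedEnclosure_of_remainderNorm_snd_neg`.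

## Design choices (recorded, as the request asks; all revisable by a v2 under new names)

* SET-VALUED normal form with hidden data `q` rather than a computed tuple: pointwise or averaged
  gap values on a patch cannot carry the patch-wide meaning the thresholds need, and Salmhofer's
  remainder is "everything not kept" relative to a kept form; the min-modulus gap semantics and the
  nodal pins make every coordinate of `Parameters` two-sidedly meaningful while `q` absorbs what a
  7-number record cannot index (Fermi-surface shifts, `Z`-factors, gap anisotropy inside a patch).
* Leg weights instead of unweighted momentum-space norms: the momentum-space `L¹` norm of a local
  quartic vertex grows like the number of Matsubara frequencies; below-scale weights make the norms
  `M`-stable and measure the remainder as seen by the fields still to be integrated.  The quadratic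
  remainder carries the plain shell weight (an energy weight there would let a declared gap certify
  itself); higher degrees carry the energy weight of the declared quasiparticles.
* `ρ_s, κ, m₀` as response coefficients of ONE functional `f_MF` (request (ii), (v)); the free
  determinant is kept whole (a soft cutoff does not split it over scales), the below-scale factor is
  the Gaussian truncation — "mean field at scale `Λ₀`".
* Conventions: `ρ_s` per site w.r.t. the vector potential `a` (`f(a) = f(0) + ½ρ_s a²`), `κ = ∂n/∂μ`
  per site, `m₀ = Re⟨Δ_d⟩/L²`; velocities in lattice units (energy × lattice spacing).
* Junk values: `L = 0`, `β ≤ 0` (empty report), `log 0 = 0`, `x/0 = 0` in the pins' velocities are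
  excluded by `0 < 1 + z`, `0 < 1 + r`; `fermiRay` is `sInf ∅ = 0` when the central ray misses the
  Fermi curve; empty patch-shells report gap `0` (`GapCondition.eq_zero`).

## Caveats and what is NOT claimed

* NON-EMPTINESS of `hubbardScaleReport U μ D h L β` for given parameters is NOT asserted: it needs
  bounds on the realised tuples uniform in `M` (the Matsubara UV problem, Pedra–Salmhofer 2008).
  `≠ Set.univ` IS proved.
* UPSTREAM (recorded for the planner, not repairable here): `hubbardCovAbove` decomposes scales
  around the BARE Fermi curve `{ε = μ}` of the free covariance; Salmhofer 1998 §2 flows the model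
  whose dispersion already contains the self-energy corrections (counterterm / adjusted reference
  dispersion).  For `U > 0` the interacting Fermi curve of `dWaveSourceTorus L U μ h` is displaced
  from `{ε = μ}` by the Hartree shift `≈ U n/2 ≫ Λ₀`, so the below-scale shell of
  `hubbardEffectiveAction` misses it; this report inherits that reference surface (its shell,
  patches and nodes are those of `{ε = μ}`).  A reference-dispersion version of the effective action
  would be consumed by the same components (`deformedCovAbove` onward) unchanged in form.
* No claim about the 2D Hubbard model, about the size of any realised parameter, or that the kept
  Cooper term exhausts the singular part of the vertex; the normalisation exponents `2m - 3` and the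
  energy weights are a CONVENTION of this v1 (nodal power counting), documented above.

## Sources

M. Salmhofer, Commun. Math. Phys. 194 (1998) 249, §2 (set-up), §2.5 ("`G₂` … is the coefficient of
the quadratic part of the effective action"), §4.1 (the norm `‖F_m‖ = max_p sup_{X_p} ∫∏_{q≠p} dX_q |F_m|`)
(arXiv:cond-mat/9706188 pp. 5, 8, 14 of the held text) [`Salmhofer1998`]; M. Salmhofer,
*Renormalization* (1999), (2.105)–(2.106), (4.85) [`Salmhofer1999`]; G. Benfatto, A. Giuliani,
V. Mastropietro, Ann. Henri Poincaré 7 (2006) 809, §2.5 (2.45)–(2.47) (sectors, local frame)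
[`BenfattoGiulianiMastropietro2006`]; J. Feldman, H. Knörrer, E. Trubowitz, CMP 247 (2004) (sectors)
[`FeldmanKnorrerTrubowitz2004`]; T. Xiang, C. Wu, *D-wave Superconductivity* (CUP 2022), §7.3
(`v_F`, `v_Δ` at the nodes), §9.2 (superfluid density = phase stiffness as current response)
[`XiangWu2022`]; D. J. Scalapino, S. R. White, S. C. Zhang, PRB 47 (1993) 7995 (superfluid weight as
flux curvature) [`ScalapinoWhiteZhang1993`]; M. E. Fisher, M. N. Barber, D. Jasnow, PRA 8 (1973) 1111
(helicity modulus) [`FisherBarberJasnow1973`]; T. Koma, H. Tasaki, J. Stat. Phys. 76 (1994) 745, §1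
(order parameter under a symmetry-breaking source) [`KomaTasaki1994`]; W. Pedra, M. Salmhofer, CMP 282
(2008) 797 (the `M → ∞` problem) [`PedraSalmhofer2008`].  The object itself is posited by the route
(a-posteriori format: Figueras–Haro–Luque 2016, Thm. 2.5), like `HubbardScaleData`.
-/

noncomputable section

namespace Literature.MathematicalPhysics.QuantumLattice

open Literature.Probability.LatticeModels GrassmannAlgebra Finset Filter

/-! ### §1 Patch geometry on the dual torus -/

section Geometry

variable (L : ℕ)

/-- The centred lattice momentum of `k ∈ (ℤ/Lℤ)²`: the representative of `2πk/L` in `(-π, π]²`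
(fundamental domain centred at `Γ = 0`, around which the Fermi curve of `ε = -2Σcos` closes for
`μ < 0`); written with `toIocMod`.  Same values as `Literature.Probability.LatticeModels.centredMomentum`
(`SlidingScaleInfraredBoundProofs.lean`, via the integer representative `Torus.rep`), whose import
closure (random currents, reflection positivity) is not wanted under the fermionic RG. [folklore] -/
def torusCentredMomentum (k : TorusSite 2 L) : Fin 2 → ℝ :=
  fun i => toIocMod Real.two_pi_pos (-Real.pi) (latticeMomentum L k i)

/-- The polar angle `θ(k⃗) ∈ (-π, π]` of a torus momentum (angle of its centred representative;
Benfatto–Giuliani–Mastropietro 2006, §2.5: sectors are indexed by the polar angle of `k⃗`).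
[cite: BenfattoGiulianiMastropietro2006, §2.5 (2.45)–(2.46)] -/
def momentumAngle (k : TorusSite 2 L) : ℝ :=
  polarAngle (torusCentredMomentum L k)

/-- `InPatch L Np i k`: the torus momentum `k` lies in the `i`-th of `Np` equal angular sectors
(patches), the sector CENTRED at the angle `2πi/Np` and half-open:
`θ(k⃗) - 2πi/Np ∈ (-π/Np, π/Np] (mod 2π)`.  For `8 ∣ Np` the axes and the diagonals are patch
centres.  (Angular sectors of the Fermi curve: Feldman–Knörrer–Trubowitz; BGM 2006 §2.5, here with
an arbitrary number `Np` of sectors instead of the dyadic `2^{n+1}`.) [folklore] -/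
def InPatch (Np : ℕ) (i : Fin Np) (k : TorusSite 2 L) : Prop :=
  toIocMod Real.two_pi_pos (-Real.pi) (momentumAngle L k - 2 * Real.pi * (i : ℕ) / Np) ∈
    Set.Ioc (-(Real.pi / Np)) (Real.pi / Np)

/-- `InShell L μ Λ₀ k`: the torus momentum `k⃗` lies in the spatial shell `|ξ_μ(k⃗)| < Λ₀` of
half-width `Λ₀` around the free Fermi curve `{ε = μ}` (the momenta that can carry a field below
scale `Λ₀`, Salmhofer's cutoff comparing `ω² + ξ²` with `Λ₀²`). [folklore] -/
def InShell (μ Λ₀ : ℝ) (k : TorusSite 2 L) : Prop :=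
  |nambuXi L μ k| < Λ₀

open Classical in
/-- The **patch-shell** `S_i`: the torus momenta of patch `i` inside the shell `|ξ_μ| < Λ₀`
(a finite set; empty when `L` is small compared with `v_F/Λ₀`). [folklore] -/
def patchShell [NeZero L] (μ Λ₀ : ℝ) (Np : ℕ) (i : Fin Np) : Finset (TorusSite 2 L) :=
  Finset.univ.filter fun k => InPatch L Np i k ∧ InShell L μ Λ₀ k

/-- The first crossing of the level `μ` by the dispersion along the ray of angle `θ`:
`inf {t ≥ 0 : ε(t · dir θ) ≥ μ}` (the Fermi radius in direction `θ` whenever the ray meets the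
Fermi curve, e.g. in the diagonal directions for `-4 ≤ μ ≤ 4`; junk `0` = `sInf ∅` otherwise).
[folklore] -/
def fermiRay (μ θ : ℝ) : ℝ :=
  sInf {t : ℝ | 0 ≤ t ∧ μ ≤ sqDispersion (t • dir θ)}

/-- The **reference node** of patch `i`: the free Fermi point on the central ray of the patch,
`κ_i = fermiRay μ θ_i · dir θ_i`, `θ_i = 2πi/Np`. [folklore] -/
def nodePoint (μ : ℝ) (Np : ℕ) (i : Fin Np) : Fin 2 → ℝ :=
  fermiRay μ (2 * Real.pi * (i : ℕ) / Np) • dir (2 * Real.pi * (i : ℕ) / Np)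

/-- The gradient `∇ε(k) = (2 sin k₁, 2 sin k₂)` of the dispersion `ε = -2(cos k₁ + cos k₂)`.
[folklore] -/
def bandGradient (k : Fin 2 → ℝ) : Fin 2 → ℝ :=
  ![2 * Real.sin (k 0), 2 * Real.sin (k 1)]

/-- The free Fermi speed `|∇ε(k)|` (Euclidean length of the gradient). [folklore] -/
def freeFermiSpeed (k : Fin 2 → ℝ) : ℝ :=
  Real.sqrt (bandGradient k 0 ^ 2 + bandGradient k 1 ^ 2)

/-- The unit tangent to the level curve of `ε` at `k`: the gradient direction rotated by `+π/2`
(junk `0` where the gradient vanishes). [folklore] -/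
def levelTangent (k : Fin 2 → ℝ) : Fin 2 → ℝ :=
  ![-(bandGradient k 1) / freeFermiSpeed k, bandGradient k 0 / freeFermiSpeed k]

/-- The **tangential coordinate** of a torus momentum relative to the reference node of patch `i`:
`t_i(k⃗) = (k⃗ - κ_i) · τ̂(κ_i)` with `k⃗` the centred momentum and `τ̂` the unit tangent to the
Fermi curve at `κ_i` (the coordinate `k'₂` of BGM 2006 (2.46)–(2.47) at the node).
[cite: BenfattoGiulianiMastropietro2006, §2.5 (2.46)–(2.47)] -/
def tangentialCoord (μ : ℝ) (Np : ℕ) (i : Fin Np) (k : TorusSite 2 L) : ℝ :=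
  (torusCentredMomentum L k 0 - nodePoint μ Np i 0) * levelTangent (nodePoint μ Np i) 0 +
    (torusCentredMomentum L k 1 - nodePoint μ Np i 1) * levelTangent (nodePoint μ Np i) 1

end Geometry

/-! ### §2 The deformed free covariance and the scale-`Λ₀` mean-field free energy -/

section Deformed

variable (L M : ℕ)

/-- The band energy from the chemical potential `μ'` with a uniform vector potential `a` on the
`x`-bonds (Peierls substitution `p₁ ↦ p₁ + s a`, `s = ±1` for the particle / the Nambu hole entry):
`ξ^{(s)}_{μ',a}(k⃗) = -2(cos(p₁ + s a) + cos p₂) - μ'`, `p = 2πk⃗/L`. [folklore] -/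
def twistedXi (μ' a s : ℝ) (k : TorusSite 2 L) : ℝ :=
  -2 * (Real.cos (latticeMomentum L k 0 + s * a) + Real.cos (latticeMomentum L k 1)) - μ'

/-- Minus the determinant of the deformed inverse Nambu propagator `-iω + M_{a,μ',h'}(k⃗)`,
`M = [[ξ₊, h'φ_d],[h'φ_d, -ξ₋]]`, `ξ± = ξ^{(±1)}_{μ',a}`:
`ω² + ξ₊ξ₋ + (h'φ_d)² - iω(ξ₋ - ξ₊)` (equal to `nambuDen = ω² + ξ² + h²φ_d²` at `a = 0`). [folklore] -/
def deformedNambuDen (β μ' h' a : ℝ) (k : FreqMomentum L M) : ℂ :=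
  (matsubaraFreq β M k.1 : ℂ) ^ 2 + (twistedXi L μ' a 1 k.2 : ℂ) * (twistedXi L μ' a (-1) k.2 : ℂ) +
      ((h' * dWaveSymbol L k.2 : ℝ) : ℂ) ^ 2 -
    Complex.I * (matsubaraFreq β M k.1 : ℂ) * ((twistedXi L μ' a (-1) k.2 : ℂ) - (twistedXi L μ' a 1 k.2 : ℂ))

/-- The **deformed Nambu propagator** `(-iω + M_{a,μ',h'}(k⃗))⁻¹` of the seeded quadratic
Hamiltonian with chemical potential `μ'`, seed `h'` and a uniform vector potential `a` on the
`x`-bonds acting on the KINETIC term only (the seed, which pins the pair phase, is untwisted — the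
London / helicity-modulus set-up), written out entrywise:
`[[iω + ξ₋, h'φ_d],[h'φ_d, iω - ξ₊]] / deformedNambuDen`. [folklore] -/
def deformedNambuPropagator (β μ' h' a : ℝ) (k : FreqMomentum L M) : Matrix (Fin 2) (Fin 2) ℂ :=
  !![(Complex.I * matsubaraFreq β M k.1 + twistedXi L μ' a (-1) k.2) / deformedNambuDen L M β μ' h' a k,
      (h' * dWaveSymbol L k.2 : ℝ) / deformedNambuDen L M β μ' h' a k;
    (h' * dWaveSymbol L k.2 : ℝ) / deformedNambuDen L M β μ' h' a k,
      (Complex.I * matsubaraFreq β M k.1 - twistedXi L μ' a 1 k.2) / deformedNambuDen L M β μ' h' a k]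

/-- Without twist the deformed band is the band: `ξ^{(s)}_{μ',0} = ξ_{μ'}`. [folklore] -/
@[simp] theorem twistedXi_zero (μ' s : ℝ) (k : TorusSite 2 L) : twistedXi L μ' 0 s k = nambuXi L μ' k := by
  simp [twistedXi, nambuXi, torusBand, Fin.sum_univ_two]

/-- Without twist the deformed denominator is `nambuDen`. [folklore] -/
theorem deformedNambuDen_zero (β μ' h' : ℝ) (k : FreqMomentum L M) :
    deformedNambuDen L M β μ' h' 0 k = (nambuDen L M β μ' h' k : ℂ) := by
  simp only [deformedNambuDen, twistedXi_zero, nambuDen, sub_self, mul_zero, sub_zero]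
  push_cast
  ring

/-- **Without twist the deformed propagator is the Nambu propagator** of `HubbardFreeCovariance`:
the response functionals below are deformations of the tree's own free covariance. [folklore] -/
theorem deformedNambuPropagator_zero (β μ' h' : ℝ) (k : FreqMomentum L M) :
    deformedNambuPropagator L M β μ' h' 0 k = nambuPropagator L M β μ' h' k := by
  ext i j
  fin_cases i <;> fin_cases j <;>
    simp [deformedNambuPropagator, nambuPropagator, deformedNambuDen_zero, twistedXi_zero]

/-- The deformed free two-point table in Nambu labels (as `nambuTwoPoint`, with the deformed
propagator): `⟨Ψ̂⁻_{k,a} Ψ̂⁺_{k,b}⟩ = βL² G_{a,μ',h'}(k)_{ab}`. [folklore] -/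
def deformedNambuTwoPoint (β μ' h' a : ℝ) (X Y : (FreqMomentum L M × Fin 2) × Fin 2) : ℂ :=
  if X.2 = 1 ∧ Y.2 = 0 ∧ X.1.1 = Y.1.1 then
    ((β * (L : ℝ) ^ 2 : ℝ) : ℂ) * deformedNambuPropagator L M β μ' h' a X.1.1 X.1.2 Y.1.2
  else 0

/-- The deformed free two-point table `⟨ψ_X ψ_Y⟩₀` of the original fields (transport along
`toNambu` and antisymmetrisation, as `hubbardTwoPoint`). [folklore] -/
def deformedTwoPoint (β μ' h' a : ℝ) (X Y : HubbardFieldIdx L M) : ℂ :=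
  deformedNambuTwoPoint L M β μ' h' a (toNambu X) (toNambu Y) -
    deformedNambuTwoPoint L M β μ' h' a (toNambu Y) (toNambu X)

/-- The **deformed free covariance** `C_{a,μ',h'}` (convention of `hubbardCovariance`:
`C(X,Y) = -⟨ψ_X ψ_Y⟩₀`). [folklore] -/
def deformedCovariance (β μ' h' a : ℝ) : Matrix (HubbardFieldIdx L M) (HubbardFieldIdx L M) ℂ :=
  Matrix.of fun X Y => -deformedTwoPoint L M β μ' h' a X Y

/-- At zero deformation the deformed covariance is the free covariance of the seeded torus.
[folklore] -/
theorem deformedCovariance_zero (β μ h : ℝ) :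
    deformedCovariance L M β μ h 0 = hubbardCovariance L M β μ h := by
  ext X Y
  simp only [deformedCovariance, hubbardCovariance, Matrix.of_apply, deformedTwoPoint, hubbardTwoPoint,
    deformedNambuTwoPoint, nambuTwoPoint, deformedNambuPropagator_zero]

/-- The **deformed covariance above scale `Λ₀`** with the cutoff weights FROZEN at the reference
data `(μ, Λ₀)`: `C^{>}_{a,μ',h'}(X,Y) = ½(w(k_X) + w(k_Y)) C_{a,μ',h'}(X,Y)`,
`w = hubbardCutoffWeight L M β μ Λ₀` — only the covariance is deformed, not the scale decomposition,
so that derivatives in `(a, μ', h')` are response coefficients at a fixed scale. [folklore] -/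
def deformedCovAbove (β μ Λ₀ μ' h' a : ℝ) : Matrix (HubbardFieldIdx L M) (HubbardFieldIdx L M) ℂ :=
  Matrix.of fun X Y =>
    (((hubbardCutoffWeight L M β μ Λ₀ (momentumOf L M X) +
        hubbardCutoffWeight L M β μ Λ₀ (momentumOf L M Y)) / 2 : ℝ) : ℂ) *
      deformedCovariance L M β μ' h' a X Y

/-- The deformed covariance at and below scale, `C^{≤}_{a,μ',h'} = C_{a,μ',h'} - C^{>}_{a,μ',h'}`.
[folklore] -/
def deformedCovBelow (β μ Λ₀ μ' h' a : ℝ) : Matrix (HubbardFieldIdx L M) (HubbardFieldIdx L M) ℂ :=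
  deformedCovariance L M β μ' h' a - deformedCovAbove L M β μ Λ₀ μ' h' a

/-- At zero deformation `C^{>}` is `hubbardCovAbove`. [folklore] -/
theorem deformedCovAbove_zero (β μ h Λ₀ : ℝ) :
    deformedCovAbove L M β μ Λ₀ μ h 0 = hubbardCovAbove L M β μ h Λ₀ := by
  ext X Y
  simp only [deformedCovAbove, hubbardCovAbove, Matrix.of_apply, deformedCovariance_zero]

/-- At zero deformation `C^{≤}` is `hubbardCovBelow`. [folklore] -/
theorem deformedCovBelow_zero (β μ h Λ₀ : ℝ) :
    deformedCovBelow L M β μ Λ₀ μ h 0 = hubbardCovBelow L M β μ h Λ₀ := by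
  rw [deformedCovBelow, hubbardCovBelow, deformedCovAbove_zero, deformedCovariance_zero]

variable [NeZero L]

/-- The **deformed effective action at scale `Λ₀`**: `effAction` of the Hubbard interaction with
the deformed covariance above scale (twist `a`, chemical potential `μ'`, seed `h'` in the
covariance; cutoff frozen at `(μ, Λ₀)`). [folklore] -/
def deformedEffAction (β U μ Λ₀ μ' h' a : ℝ) : HubbardGrassmann L M :=
  effAction ℂ (deformedCovAbove L M β μ Λ₀ μ' h' a) (hubbardInteraction L M β U)

/-- The deformed normalised partition function at scale `Λ₀`, `Z^{>}_{a,μ',h'} = ∫ dμ_{C^{>}} e^{-V}`.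
[folklore] -/
def deformedEffPartitionFn (β U μ Λ₀ μ' h' a : ℝ) : ℂ :=
  effPartitionFn ℂ (deformedCovAbove L M β μ Λ₀ μ' h' a) (hubbardInteraction L M β U)

/-- **At zero deformation the deformed effective action is `hubbardEffectiveAction`** — the
response coefficients below are derivatives of functionals of the tree's effective action itself.
[folklore] -/
theorem deformedEffAction_zero (β U μ h Λ₀ : ℝ) :
    deformedEffAction L M β U μ Λ₀ μ h 0 = hubbardEffectiveAction L M β U μ h Λ₀ := by
  rw [deformedEffAction, deformedCovAbove_zero, hubbardEffectiveAction]

/-- At zero deformation `Z^{>}` is `hubbardEffPartitionFn`. [folklore] -/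
theorem deformedEffPartitionFn_zero (β U μ h Λ₀ : ℝ) :
    deformedEffPartitionFn L M β U μ Λ₀ μ h 0 = hubbardEffPartitionFn L M β U μ h Λ₀ := by
  rw [deformedEffPartitionFn, deformedCovAbove_zero, hubbardEffPartitionFn]

omit [NeZero L] in
/-- The **quadratic part** `F₂ = Σ_{X,Y} F₂(X,Y) ψ_X ψ_Y` of a Grassmann polynomial, rebuilt from
its antisymmetric two-point kernel `kernel F 2` (Salmhofer 1998, §2.5: the coefficient of the
quadratic part of the effective action is the connected amputated two-point function).
[cite: Salmhofer1998, §2.5] -/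
def quadraticPart {Γ : Type*} [Fintype Γ] [DecidableEq Γ] (F : GrassmannAlgebra ℂ Γ) : GrassmannAlgebra ℂ Γ :=
  ∑ X : Γ, ∑ Y : Γ, kernel ℂ F 2 ![X, Y] • (gen ℂ X * gen ℂ Y)

/-- The free (Gaussian) log-determinant of the deformed quadratic Hamiltonian at `2M` Matsubara
frequencies: `Σ_k log |det(-iω_k + M_{a,μ',h'}(k⃗))|` (one Nambu mode `k` = the pair of modes
`(k↑), (-k↓)`; the `(a,μ',h')`-independent normalisation of the Grassmann measure is dropped).
[folklore] -/
def freeLogDet (β μ' h' a : ℝ) : ℝ :=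
  ∑ k : FreqMomentum L M, Real.log ‖deformedNambuDen L M β μ' h' a k‖

/-- The **scale-`Λ₀` mean-field free energy per site** of the deformed seeded Hubbard torus,
`f_MF(a, μ', h') = -(βL²)⁻¹ [ log N(a,μ',h') + log |Z^{>}| + log |∫ dμ_{C^{≤}} e^{-𝒢₂}| ]`:
the exact grand potential `-(βL²)⁻¹ log (N · Z^{>} · ∫ dμ_{C^{≤}} e^{-𝒢})` (free determinant ×
above-scale partition function × below-scale integral of the effective Boltzmann factor, Salmhofer
1999 (2.105)/(4.85)) with the below-scale integral evaluated in the QUADRATIC (mean-field)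
truncation `𝒢 ↦ 𝒢₂` of the deformed effective action.  Its derivatives at `(0, μ, h)` are the
response coefficients of the report (`scaleStiffness`, `scaleCompressibility`,
`scaleMeanFieldDensity`).  Junk (`log 0 = 0`) where a factor vanishes. [folklore] -/
def mfFreeEnergy (β U μ Λ₀ μ' h' a : ℝ) : ℝ :=
  -(1 / (β * (L : ℝ) ^ 2)) *
    (freeLogDet L M β μ' h' a + Real.log ‖deformedEffPartitionFn L M β U μ Λ₀ μ' h' a‖ +
      Real.log ‖gaussExpect ℂ (deformedCovBelow L M β μ Λ₀ μ' h' a)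
        (grassmannExp (-quadraticPart (deformedEffAction L M β U μ Λ₀ μ' h' a)))‖)

/-- The **phase stiffness at scale `Λ₀`** (finite `L, M, β`): the curvature at `a = 0` of the
scale-`Λ₀` mean-field free energy per site in a uniform vector potential `a` on the `x`-bonds with
the pair phase pinned by the seed, `ρ_s = ∂²_a f_MF(a, μ, h)|_{a=0}` — the superfluid weight /
phase stiffness as a static current response (Xiang–Wu 2022, §9.2; Scalapino–White–Zhang 1993; the
helicity modulus of Fisher–Barber–Jasnow 1973 is this curvature w.r.t. the order-parameter phase
gradient `2a`, i.e. `ρ_s/4`). [cite: XiangWu2022, §9.2] -/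
def scaleStiffness (β U μ h Λ₀ : ℝ) : ℝ :=
  iteratedDeriv 2 (fun a => mfFreeEnergy L M β U μ Λ₀ μ h a) 0

/-- The **pair compressibility at scale `Λ₀`** (finite `L, M, β`): `κ = -∂²_{μ'} f_MF(0, μ', h)|_{μ'=μ}
= ∂n_MF/∂μ` (compressibility of the scale-`Λ₀` mean-field free energy; the coefficient of
`(∂_τθ)²` in the pair-phase action is `κ/4`). [folklore] -/
def scaleCompressibility (β U μ h Λ₀ : ℝ) : ℝ :=
  -iteratedDeriv 2 (fun μ' => mfFreeEnergy L M β U μ Λ₀ μ' h 0) μ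

/-- The **mean-field anomalous `B₁g` density at scale `Λ₀`** (finite `L, M, β`):
`m₀ = -½ ∂_{h'} f_MF(0, μ, h')|_{h'=h}`, i.e. `Re ⟨Δ_d⟩/L²` (`∂F/∂h' = -⟨Δ_d + Δ_d†⟩` for the source
`-h'(Δ_d + Δ_d†)`) of the model whose below-scale integral is truncated to the quadratic part of the
effective action — the normalisation of `dWaveSourceDensity` (Koma–Tasaki 1994, §1).
[cite: KomaTasaki1994, §1] -/
def scaleMeanFieldDensity (β U μ h Λ₀ : ℝ) : ℝ :=
  -(1 / 2) * deriv (fun h' => mfFreeEnergy L M β U μ Λ₀ μ h' 0) h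

end Deformed

/-! ### §3 Leg-weighted `L¹–L^∞` kernel norms -/

section Norms

variable {𝕜 : Type*} [RCLike 𝕜] {Γ : Type*} [Fintype Γ] [DecidableEq Γ]

/-- Salmhofer's `L¹–L^∞` kernel norm with a WEIGHT `wt` on every leg:
`max_p sup_{X_p} ε^{m-1} Σ_{(X_q)_{q≠p}} (∏_q wt(X_q)) |K(X)|` for `m ≥ 1` and `|K(∅)|` for `m = 0`
(Salmhofer 1998, §4.1, the norm of Gawȩdzki–Kupiainen, here in momentum space with integration
weight `ε` and field weights `wt` — `wt = 1` is `kernelNorm`). [cite: Salmhofer1998, §4.1 (norm before Lemma 1)] -/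
def legKernelNorm (wt : Γ → ℝ) (ε : ℝ) : (m : ℕ) → ((Fin m → Γ) → 𝕜) → ℝ
  | 0, K => ‖K Fin.elim0‖
  | m + 1, K => ⨆ p : Fin (m + 1), ⨆ x : Γ,
      ε ^ m * ∑ X ∈ Finset.univ.filter (fun X : Fin (m + 1) → Γ => X p = x), (∏ q, wt (X q)) * ‖K X‖

/-- Unfolding `legKernelNorm` in degree `0`. [folklore] -/
theorem legKernelNorm_zero_left (wt : Γ → ℝ) (ε : ℝ) (K : (Fin 0 → Γ) → 𝕜) :
    legKernelNorm wt ε 0 K = ‖K Fin.elim0‖ := rfl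

/-- Unfolding `legKernelNorm` in positive degree. [folklore] -/
theorem legKernelNorm_succ (wt : Γ → ℝ) (ε : ℝ) (m : ℕ) (K : (Fin (m + 1) → Γ) → 𝕜) :
    legKernelNorm wt ε (m + 1) K = ⨆ p : Fin (m + 1), ⨆ x : Γ,
      ε ^ m * ∑ X ∈ Finset.univ.filter (fun X : Fin (m + 1) → Γ => X p = x), (∏ q, wt (X q)) * ‖K X‖ := rfl

/-- The zero kernel has leg-weighted norm `0`. [folklore] -/
theorem legKernelNorm_zero_kernel (wt : Γ → ℝ) (ε : ℝ) (m : ℕ) :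
    legKernelNorm wt ε m (0 : (Fin m → Γ) → 𝕜) = 0 := by
  cases m with
  | zero => simp [legKernelNorm]
  | succ m => simp [legKernelNorm]

/-- The leg-weighted norm is nonnegative for nonnegative weights. [folklore] -/
theorem legKernelNorm_nonneg {wt : Γ → ℝ} (hwt : ∀ X, 0 ≤ wt X) {ε : ℝ} (hε : 0 ≤ ε) (m : ℕ)
    (K : (Fin m → Γ) → 𝕜) : 0 ≤ legKernelNorm wt ε m K := by
  cases m with
  | zero => exact norm_nonneg _
  | succ m =>
    rw [legKernelNorm_succ]
    rcases isEmpty_or_nonempty Γ with hΓ | hΓ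
    · simp
    · exact le_ciSup_of_le (Finite.bddAbove_range _) 0 (le_ciSup_of_le (Finite.bddAbove_range _)
        (Classical.arbitrary Γ) (mul_nonneg (pow_nonneg hε _)
          (Finset.sum_nonneg fun _ _ => mul_nonneg (Finset.prod_nonneg fun q _ => hwt _) (norm_nonneg _))))

/-- With unit weights the leg-weighted norm is `kernelNorm`. [folklore] -/
theorem legKernelNorm_one (ε : ℝ) (m : ℕ) (K : (Fin m → Γ) → 𝕜) :
    legKernelNorm (fun _ => (1 : ℝ)) ε m K = kernelNorm ε m K := by
  cases m with
  | zero => rfl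
  | succ m => simp [legKernelNorm_succ, kernelNorm_succ]

end Norms

/-! ### §4 The quasiparticle normal form, the kept Cooper term and the scaled remainder norm -/

/-- **Normal-form data** (the hidden, existentially quantified part of a scale report): static real
functions on the torus momenta — the normal (Fermi-surface) shift `n`, the anomalous self-energy `a`
and the field renormalisation `z` of the quadratic quasiparticle form
`ε Σ_k [(n(k⃗) - iω z(k⃗))(ψ⁺_{k↑}ψ⁻_{k↑} + ψ⁺_{k↓}ψ⁻_{k↓}) + a(k⃗)(ψ⁺_{k↑}ψ⁺_{-k↓} + ψ⁻_{-k↓}ψ⁻_{k↑})]` —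
and, per patch, the seven constants pinning the nodal Dirac cone on the patches declared nodal
(`z`, velocity renormalisation `r`, shift `s`, even profile `c₂, c₄`, gap slope `v_a`, cubic `d₃`).
Posited by route HubbardSuperconductivity/AposterioriCapRg (definition request
`defn-hubbardScaleReport`, items (iii)–(iv)). [folklore] -/
structure HubbardNormalForm (L Np : ℕ) where
  /-- The static normal self-energy (shift of `ξ`) `n(k⃗)`. -/
  shift : TorusSite 2 L → ℝ
  /-- The static anomalous self-energy `a(k⃗)` (the gap function is `hφ_d + a`). -/
  anom : TorusSite 2 L → ℝ
  /-- The field renormalisation `z(k⃗)` (coefficient of `-iω` is `1 + z`). -/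
  zren : TorusSite 2 L → ℝ
  /-- Nodal pin: the constant value of `z` on a nodal patch-shell. -/
  nodeZ : Fin Np → ℝ
  /-- Nodal pin: the Fermi-velocity renormalisation `r` (`ξ ↦ (1 + r)ξ`). -/
  nodeR : Fin Np → ℝ
  /-- Nodal pin: the constant normal shift `s`. -/
  nodeS : Fin Np → ℝ
  /-- Nodal pin: the coefficient of `t²` in the normal shift profile. -/
  nodeC₂ : Fin Np → ℝ
  /-- Nodal pin: the coefficient of `t⁴` in the normal shift profile. -/
  nodeC₄ : Fin Np → ℝ
  /-- Nodal pin: the bare gap slope `v_a` (`Δ = v_a t + d₃ t³`). -/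
  nodeVa : Fin Np → ℝ
  /-- Nodal pin: the cubic coefficient `d₃` of the gap. -/
  nodeD₃ : Fin Np → ℝ

namespace HubbardNormalForm

variable {L Np : ℕ}

/-- Site-inversion (parity) covariance of the normal-form data: `n`, `a`, `z` are even in `k⃗`
(so the quadratic form is parity-even and the pairing spin-singlet). [folklore] -/
def IsEven (q : HubbardNormalForm L Np) : Prop :=
  ∀ k : TorusSite 2 L, q.shift (-k) = q.shift k ∧ q.anom (-k) = q.anom k ∧ q.zren (-k) = q.zren k

end HubbardNormalForm

section NormalForm

variable (L M : ℕ) {Np : ℕ}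

/-- The **gap function** of a normal form: seed plus anomalous self-energy,
`Δ(k⃗) = h φ_d(k⃗) + a(k⃗)` (the off-diagonal Nambu entry of the quadratic form of the fields deep
below scale). [folklore] -/
def gapFunction (h : ℝ) (q : HubbardNormalForm L Np) (k : TorusSite 2 L) : ℝ :=
  h * dWaveSymbol L k + q.anom k

/-- The static **quasiparticle energy** of a normal form, `E(k⃗) = √((ξ_μ + n)² + Δ²)`. [folklore] -/
def modelEnergy (μ h : ℝ) (q : HubbardNormalForm L Np) (k : TorusSite 2 L) : ℝ :=
  Real.sqrt ((nambuXi L μ k + q.shift k) ^ 2 + gapFunction L h q k ^ 2)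

variable [NeZero L]

/-- The **quadratic quasiparticle form** of the normal-form data `q` as an element of the Grassmann
algebra (momentum-space weight `ε = (βL²)⁻¹`, the monomials of the free seeded action, cf.
`hubbardCovariance`): `𝒬(q) = ε Σ_k [(n(k⃗) - iω_k z(k⃗))(ψ⁺_{k↑}ψ⁻_{k↑} + ψ⁺_{k↓}ψ⁻_{k↓})
+ a(k⃗)(ψ⁺_{k↑}ψ⁺_{-k↓} + ψ⁻_{-k↓}ψ⁻_{k↑})]`, `-k = k.neg`. [folklore] -/
def normalFormQuadratic (β : ℝ) (q : HubbardNormalForm L Np) : HubbardGrassmann L M :=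
  ∑ k : FreqMomentum L M, ((1 / (β * (L : ℝ) ^ 2) : ℝ) : ℂ) •
    (((q.shift k.2 : ℂ) - Complex.I * (matsubaraFreq β M k.1 : ℂ) * (q.zren k.2 : ℂ)) •
        (psiPlus k 0 * psiMinus k 0 + psiPlus k 1 * psiMinus k 1) +
      (q.anom k.2 : ℂ) • (psiPlus k 0 * psiPlus k.neg 1 + psiMinus k.neg 1 * psiMinus k 0))

/-- `InFreqShell`: the frequency–momentum label `k = (ω, k⃗)` is below scale, `ω² + ξ_μ(k⃗)² < Λ₀²`
(exactly where the below-scale weight `1 - χ₂((ω² + ξ²)/Λ₀²)` is positive). [folklore] -/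
def InFreqShell (β μ Λ₀ : ℝ) (k : FreqMomentum L M) : Prop :=
  matsubaraFreq β M k.1 ^ 2 + nambuXi L μ k.2 ^ 2 < Λ₀ ^ 2

/-- The pair label `q = k + k'` of two fermionic labels: integer frequency label `n + n'` (the pair
frequency is `2π(n + n' + 1)/β`) and total torus momentum. [folklore] -/
def pairLabel (k k' : FreqMomentum L M) : ℤ × TorusSite 2 L :=
  (matsubaraInt M k.1 + matsubaraInt M k'.1, k.2 + k'.2)

/-- The symmetrised `B₁g` pair form factor `½(φ_d(k⃗) + φ_d(k⃗'))` of a singlet pair `(k↑, k'↓)`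
(equal to `φ_d(k⃗)` at zero pair momentum, `φ_d` even). [folklore] -/
def pairFormFactor (k k' : FreqMomentum L M) : ℝ :=
  (dWaveSymbol L k.2 + dWaveSymbol L k'.2) / 2

/-- The **reduced singlet Cooper vertex** of `F`: `(βL²)³` times the coefficient of the canonical
monomial `ψ⁺_{k₁↑} ψ⁺_{k₂↓} ψ⁻_{k₄↓} ψ⁻_{k₃↑}` in `F` (extracted by the iterated derivative,
`GrassmannKernels.iterDeriv`, and the constant part). [folklore] -/
def cooperVertex (β : ℝ) (F : HubbardGrassmann L M) (k₁ k₂ k₃ k₄ : FreqMomentum L M) : ℂ :=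
  (((β * (L : ℝ) ^ 2) ^ 3 : ℝ) : ℂ) *
    constPart ℂ (iterDeriv ℂ ![((k₁, 0), 0), ((k₂, 1), 0), ((k₄, 1), 1), ((k₃, 0), 1)] F)

open Classical in
/-- The below-scale singlet pairs with pair label `q = k₁ + k₂`. [folklore] -/
def shellPairs (β μ Λ₀ : ℝ) (k₁ k₂ : FreqMomentum L M) : Finset (FreqMomentum L M × FreqMomentum L M) :=
  Finset.univ.filter fun kk =>
    pairLabel L M kk.1 kk.2 = pairLabel L M k₁ k₂ ∧ InFreqShell L M β μ Λ₀ kk.1 ∧ InFreqShell L M β μ Λ₀ kk.2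

/-- The **`B₁g` Cooper-channel coefficient** `D̂_F(q)` of `F` at the pair label `q = k₁ + k₂`:
the projection of the reduced singlet Cooper vertex, restricted to below-scale legs, onto the
form factor `f ⊗ f`, `f = pairFormFactor`: `Σ f(k,k') f(p,p') Γ(k,k',p,p') / (Σ f²)²` over
below-scale pairs of label `q` (junk `0` when no such pair exists). [folklore] -/
def cooperCoefficient (β μ Λ₀ : ℝ) (F : HubbardGrassmann L M) (k₁ k₂ : FreqMomentum L M) : ℂ :=
  (∑ kk ∈ shellPairs L M β μ Λ₀ k₁ k₂, ∑ pp ∈ shellPairs L M β μ Λ₀ k₁ k₂,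
      ((pairFormFactor L M kk.1 kk.2 * pairFormFactor L M pp.1 pp.2 : ℝ) : ℂ) *
        cooperVertex L M β F kk.1 kk.2 pp.1 pp.2) /
    ((∑ kk ∈ shellPairs L M β μ Λ₀ k₁ k₂, pairFormFactor L M kk.1 kk.2 ^ 2 : ℝ) : ℂ) ^ 2

open Classical in
/-- The **kept Cooper term** `𝒦(F)`: the `B₁g` spin-singlet Cooper-channel part of the quartic
part of `F` among below-scale legs — at every pair label `q` the rank-one (in form-factor space)
vertex `ε³ D̂_F(q) f(k₁,k₂) f(k₃,k₄) ψ⁺_{k₁↑}ψ⁺_{k₂↓}ψ⁻_{k₄↓}ψ⁻_{k₃↑}`, `k₁ + k₂ = k₃ + k₄ = q`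
(the pair-fluctuation — phase and amplitude — exchange of the `d_{x²-y²}` channel, the purely
fermionic stand-in for `S_phase + S_mix` requested by the route; everything else quartic is
remainder). [folklore] -/
def cooperKept (β μ Λ₀ : ℝ) (F : HubbardGrassmann L M) : HubbardGrassmann L M :=
  ∑ k₁ : FreqMomentum L M, ∑ k₂ : FreqMomentum L M, ∑ k₃ : FreqMomentum L M, ∑ k₄ : FreqMomentum L M,
    if pairLabel L M k₁ k₂ = pairLabel L M k₃ k₄ ∧ InFreqShell L M β μ Λ₀ k₁ ∧ InFreqShell L M β μ Λ₀ k₂ ∧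
        InFreqShell L M β μ Λ₀ k₃ ∧ InFreqShell L M β μ Λ₀ k₄ then
      ((((1 / (β * (L : ℝ) ^ 2)) ^ 3 : ℝ) : ℂ) * cooperCoefficient L M β μ Λ₀ F k₁ k₂ *
          ((pairFormFactor L M k₁ k₂ * pairFormFactor L M k₃ k₄ : ℝ) : ℂ)) •
        (psiPlus k₁ 0 * psiPlus k₂ 1 * psiMinus k₄ 1 * psiMinus k₃ 0)
    else 0

/-- The **shell leg weight** `√(1 - w_{Λ₀}(k_X))` of a field label (`w` the above-scale cutoff
weight at the reference `(μ, Λ₀)`; positive exactly below scale): the weight of the legs in the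
norm of the QUADRATIC remainder. [folklore] -/
def shellLegWeight (β μ Λ₀ : ℝ) (X : HubbardFieldIdx L M) : ℝ :=
  Real.sqrt (1 - hubbardCutoffWeight L M β μ Λ₀ (momentumOf L M X))

/-- The **energy leg weight** `√((1 - w_{Λ₀}(k_X)) · Λ₀ / max(Λ₀, E(k⃗_X)))` of a field label: the
shell weight reduced on legs that the normal form declares gapped (`E` its static quasiparticle
energy) — the relative size of a below-scale propagator of that leg at scale `Λ₀`; the weight of
the legs in the norm of the remainder of degree `≠ 2`. [folklore] -/
def energyLegWeight (β μ h Λ₀ : ℝ) (q : HubbardNormalForm L Np) (X : HubbardFieldIdx L M) : ℝ :=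
  Real.sqrt ((1 - hubbardCutoffWeight L M β μ Λ₀ (momentumOf L M X)) *
    (Λ₀ / max Λ₀ (modelEnergy L μ h q (momentumOf L M X).2)))

/-- The **remainder** of the effective action at scale `Λ₀` w.r.t. the normal-form data `q`:
`𝒢 - 𝒬(q) - 𝒦(𝒢)`, `𝒢 = hubbardEffectiveAction L M β U μ h Λ₀`. [folklore] -/
def remainderOf (β U μ h Λ₀ : ℝ) (q : HubbardNormalForm L Np) : HubbardGrassmann L M :=
  hubbardEffectiveAction L M β U μ h Λ₀ - normalFormQuadratic L M β q -
    cooperKept L M β μ Λ₀ (hubbardEffectiveAction L M β U μ h Λ₀)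

/-- The **scaled remainder norm** `η(q) = Σ_m Λ₀^{-(2m-3)} ‖R_m‖_m` of the remainder
`R = 𝒢 - 𝒬(q) - 𝒦(𝒢)`: Salmhofer's `L¹–L^∞` norms (momentum space, weight `ε = (βL²)⁻¹`) of
Salmhofer's kernels `weightedKernel ε R m`, with leg weights `shellLegWeight` in degree `2` and
`energyLegWeight` in the other degrees, each degree divided by its natural size at scale `Λ₀`
(`Λ₀` for the quadratic part; `Λ₀^{2m-3}` for an `m`-point vertex that is marginal in the power
counting of nodal quasiparticles with the energy-weighted below-scale phase space `∝ Λ₀³` per leg)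
— so that relevant unabsorbed terms blow up, marginal ones are `O(1)` and irrelevant ones vanish as
`Λ₀ → 0`.  Degrees above `|Γ|` carry no monomials. [folklore] -/
def scaledRemainderNorm (β U μ h Λ₀ : ℝ) (q : HubbardNormalForm L Np) : ℝ :=
  ∑ m ∈ Finset.range (Fintype.card (HubbardFieldIdx L M) + 1),
    Λ₀ ^ (-(2 * (m : ℤ) - 3)) *
      legKernelNorm (if m = 2 then shellLegWeight L M β μ Λ₀ else energyLegWeight L M β μ h Λ₀ q)
        (1 / (β * (L : ℝ) ^ 2)) m
        (weightedKernel (1 / (β * (L : ℝ) ^ 2)) (remainderOf L M β U μ h Λ₀ q) m)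

omit [NeZero L] in
/-- The leg weights are nonnegative. [folklore] -/
theorem shellLegWeight_nonneg (β μ Λ₀ : ℝ) (X : HubbardFieldIdx L M) : 0 ≤ shellLegWeight L M β μ Λ₀ X :=
  Real.sqrt_nonneg _

omit [NeZero L] in
/-- The energy leg weights are nonnegative. [folklore] -/
theorem energyLegWeight_nonneg (β μ h Λ₀ : ℝ) (q : HubbardNormalForm L Np) (X : HubbardFieldIdx L M) :
    0 ≤ energyLegWeight L M β μ h Λ₀ q X :=
  Real.sqrt_nonneg _

/-- **The scaled remainder norm is nonnegative** (`β > 0`, `Λ₀ ≥ 0`). [folklore] -/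
theorem scaledRemainderNorm_nonneg {β Λ₀ : ℝ} (hβ : 0 < β) (hΛ : 0 ≤ Λ₀) (U μ h : ℝ)
    (q : HubbardNormalForm L Np) : 0 ≤ scaledRemainderNorm L M β U μ h Λ₀ q := by
  refine Finset.sum_nonneg fun m _ => mul_nonneg (zpow_nonneg hΛ _) (legKernelNorm_nonneg ?_ ?_ _ _)
  · intro X
    split_ifs
    · exact shellLegWeight_nonneg L M β μ Λ₀ X
    · exact energyLegWeight_nonneg L M β μ h Λ₀ q X
  · have hL : (0 : ℝ) < (L : ℝ) := by exact_mod_cast Nat.pos_of_ne_zero (NeZero.ne L)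
    positivity

end NormalForm

/-! ### §5 The report -/

namespace HubbardScaleData.Parameters

variable {Np : ℕ}

/-- `p.IsClose p' δ`: the two parameter tuples are coordinatewise `δ`-close (the product uniform
structure on `Parameters Np`, written out). [folklore] -/
def IsClose (p p' : Parameters Np) (δ : ℝ) : Prop :=
  (∀ i, |p.gap i - p'.gap i| < δ) ∧ |p.stiffness - p'.stiffness| < δ ∧
    |p.compressibility - p'.compressibility| < δ ∧ |p.fermiVelocity - p'.fermiVelocity| < δ ∧
    |p.gapVelocity - p'.gapVelocity| < δ ∧ |p.remainderNorm - p'.remainderNorm| < δ ∧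
    |p.meanFieldDensity - p'.meanFieldDensity| < δ

/-- Closeness is reflexive. [folklore] -/
theorem isClose_self (p : Parameters Np) {δ : ℝ} (hδ : 0 < δ) : p.IsClose p δ := by
  simp [IsClose, hδ]

end HubbardScaleData.Parameters

section Report

variable (L M : ℕ) [NeZero L] {Np : ℕ}

/-- `GapCondition`: the number `g` reports the gap function `Δ = gapFunction L h q` on the
patch-shell `S_i` in the MIN-MODULUS sense — if `S_i = ∅` then `g = 0`; otherwise `g` is a value of
`Δ` on `S_i` of modulus `≤ |Δ(k⃗)|` for every `k⃗ ∈ S_i` (so an enclosure `|g| ≥ c Λ₀` certifies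
`|Δ| ≥ c Λ₀` on the whole patch-shell). [folklore] -/
def GapCondition (μ h Λ₀ : ℝ) (q : HubbardNormalForm L Np) (i : Fin Np) (g : ℝ) : Prop :=
  (patchShell L μ Λ₀ Np i = ∅ → g = 0) ∧
    (patchShell L μ Λ₀ Np i ≠ ∅ → ∃ k ∈ patchShell L μ Λ₀ Np i, g = gapFunction L h q k) ∧
    ∀ k ∈ patchShell L μ Λ₀ Np i, |g| ≤ |gapFunction L h q k|

/-- `SignCondition`: the gap function has a constant sign on the patch-shell `S_i` (required on the
patches NOT declared nodal: a sign change of `Δ` inside a patch is a node). [folklore] -/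
def SignCondition (μ h Λ₀ : ℝ) (q : HubbardNormalForm L Np) (i : Fin Np) : Prop :=
  ∀ k ∈ patchShell L μ Λ₀ Np i, ∀ k' ∈ patchShell L μ Λ₀ Np i, 0 ≤ gapFunction L h q k * gapFunction L h q k'

/-- `NodalCondition`: on the patch-shell of a patch DECLARED NODAL the normal form is a pinned
Dirac cone about the reference node `κ_i` in the tangential coordinate `t = tangentialCoord`:
`z ≡ z_i`, `Δ(k⃗) = v_a t + d₃ t³` (odd), `ξ + n = s + (1 + r) ξ + c₂ t² + c₄ t⁴` (even profile on the
renormalised band), with `1 + z_i > 0`, `1 + r_i > 0`; and the reported velocities are the cone's,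
`v_F = (1 + r_i) |∇ε(κ_i)| / (1 + z_i)` and `v_Δ = |v_a| / (1 + z_i)` (Xiang–Wu 2022, §7.3: the
d-wave quasiparticle dispersion at a node is set by `v_F` along the nodal direction and the gap
slope `v_Δ` across it).  A dishonest nodal declaration makes the pins unsatisfiable with a small
remainder. [cite: XiangWu2022, §7.3] -/
def NodalCondition (μ h Λ₀ : ℝ) (q : HubbardNormalForm L Np) (i : Fin Np) (vF vΔ : ℝ) : Prop :=
  0 < 1 + q.nodeZ i ∧ 0 < 1 + q.nodeR i ∧
    (∀ k ∈ patchShell L μ Λ₀ Np i,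
      q.zren k = q.nodeZ i ∧
        gapFunction L h q k =
          q.nodeVa i * tangentialCoord L μ Np i k + q.nodeD₃ i * tangentialCoord L μ Np i k ^ 3 ∧
        nambuXi L μ k + q.shift k =
          q.nodeS i + (1 + q.nodeR i) * nambuXi L μ k + q.nodeC₂ i * tangentialCoord L μ Np i k ^ 2 +
            q.nodeC₄ i * tangentialCoord L μ Np i k ^ 4) ∧
    vF = (1 + q.nodeR i) * freeFermiSpeed (nodePoint μ Np i) / (1 + q.nodeZ i) ∧
    vΔ = |q.nodeVa i| / (1 + q.nodeZ i)

/-- **`IsRealisedAt L M β U μ h Λ₀ Np nodal p`: the parameter tuple `p` is realised by the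
scale-`Λ₀` effective action of the seeded Hubbard torus at `(L, β)` with `2M` Matsubara
frequencies** — the ONE normal-form predicate of the report: `β > 0` and there are parity-even
normal-form data `q` such that (gap) every `p.gap i` reports the gap function on patch `i` in the
min-modulus sense and the gap function has a constant sign on every patch-shell not declared
nodal; (cones) on every patch declared nodal the normal form is the pinned Dirac cone
with velocities `(p.fermiVelocity, p.gapVelocity)`; (responses) `p.stiffness`, `p.compressibility`,
`p.meanFieldDensity` ARE the scale-`Λ₀` response coefficients `ρ_s`, `κ`, `m₀`; (remainder) the
scaled remainder norm of `𝒢 - 𝒬(q) - 𝒦(𝒢)` is at most `p.remainderNorm`. [folklore] -/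
def IsRealisedAt (β U μ h Λ₀ : ℝ) (Np : ℕ) (nodal : Finset (Fin Np)) (p : HubbardScaleData.Parameters Np) : Prop :=
  0 < β ∧ ∃ q : HubbardNormalForm L Np,
    q.IsEven ∧
    (∀ i, GapCondition L μ h Λ₀ q i (p.gap i)) ∧
    (∀ i ∉ nodal, SignCondition L μ h Λ₀ q i) ∧
    (∀ i ∈ nodal, NodalCondition L μ h Λ₀ q i p.fermiVelocity p.gapVelocity) ∧
    p.stiffness = scaleStiffness L M β U μ h Λ₀ ∧
    p.compressibility = scaleCompressibility L M β U μ h Λ₀ ∧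
    p.meanFieldDensity = scaleMeanFieldDensity L M β U μ h Λ₀ ∧
    scaledRemainderNorm L M β U μ h Λ₀ q ≤ p.remainderNorm

variable {L M}

/-- A realised tuple has a nonnegative remainder norm (`Λ₀ ≥ 0`). [folklore] -/
theorem IsRealisedAt.remainderNorm_nonneg {β U μ h Λ₀ : ℝ} {nodal : Finset (Fin Np)}
    {p : HubbardScaleData.Parameters Np} (hΛ : 0 ≤ Λ₀) (hp : IsRealisedAt L M β U μ h Λ₀ Np nodal p) :
    0 ≤ p.remainderNorm := by
  obtain ⟨hβ, q, -, -, -, -, -, -, -, hη⟩ := hp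
  exact (scaledRemainderNorm_nonneg L M hβ hΛ U μ h q).trans hη

/-- **Min-modulus semantics**: a reported gap bounds the gap function from below in modulus on the
whole patch-shell. [folklore] -/
theorem GapCondition.abs_le_abs {μ h Λ₀ : ℝ} {q : HubbardNormalForm L Np} {i : Fin Np} {g : ℝ}
    (hg : GapCondition L μ h Λ₀ q i g) {k : TorusSite 2 L} (hk : k ∈ patchShell L μ Λ₀ Np i) :
    |g| ≤ |gapFunction L h q k| :=
  hg.2.2 k hk

/-- On an empty patch-shell the reported gap is `0` (no vacuous certification of a gap). [folklore] -/
theorem GapCondition.eq_zero {μ h Λ₀ : ℝ} {q : HubbardNormalForm L Np} {i : Fin Np} {g : ℝ}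
    (hg : GapCondition L μ h Λ₀ q i g) (he : patchShell L μ Λ₀ Np i = ∅) : g = 0 :=
  hg.1 he

/-- What a consumer of the report extracts from a realised tuple: parity-even normal-form data whose
gap function dominates the reported gaps in modulus on every patch-shell and whose scaled remainder
is within the reported norm (combine with `HubbardScaleData.MeetsThresholdsWith.le_abs_gap` to get
`c Λ₀ ≤ |Δ|` on every non-nodal patch-shell of a certified datum). [folklore] -/
theorem IsRealisedAt.exists_normalForm {β U μ h Λ₀ : ℝ} {nodal : Finset (Fin Np)}
    {p : HubbardScaleData.Parameters Np} (hp : IsRealisedAt L M β U μ h Λ₀ Np nodal p) :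
    ∃ q : HubbardNormalForm L Np, q.IsEven ∧
      (∀ i, ∀ k ∈ patchShell L μ Λ₀ Np i, |p.gap i| ≤ |gapFunction L h q k|) ∧
      (∀ i ∉ nodal, SignCondition L μ h Λ₀ q i) ∧
      (∀ i ∈ nodal, NodalCondition L μ h Λ₀ q i p.fermiVelocity p.gapVelocity) ∧
      scaledRemainderNorm L M β U μ h Λ₀ q ≤ p.remainderNorm := by
  obtain ⟨-, q, heven, hgap, hsign, hnod, -, -, -, hη⟩ := hp
  exact ⟨q, heven, fun i k hk => (hgap i).abs_le_abs hk, hsign, hnod, hη⟩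

end Report

/-! ### The free case `U = 0`: zero effective action, zero remainder — the predicate is satisfiable -/

section Free

variable (R : Type*) [CommRing R] [Algebra ℚ R] {Γ : Type*} [Fintype Γ]

/-- With zero interaction the effective action vanishes: `effAction C 0 = 0` (`μ_C ⋆ 1 = 1`, `Z = 1`,
`log 1 = 0`). [folklore] -/
theorem effAction_zero_interaction (C : Matrix Γ Γ R) : effAction R C 0 = 0 := by
  have hB : effBoltzmann R C 0 = 1 := by
    rw [effBoltzmann, neg_zero, grassmannExp, IsNilpotent.exp_zero, gaussConv_one]
  have hZ : effPartitionFn R C 0 = 1 := by rw [effPartitionFn, hB, map_one]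
  rw [effAction, hZ, hB, Ring.inverse_one, one_smul, sub_self, grassmannLog1p_zero, neg_zero]

variable (L M : ℕ) [NeZero L] {Np : ℕ}

/-- At `U = 0` the Hubbard interaction vanishes. [folklore] -/
theorem hubbardInteraction_zero_coupling (β : ℝ) : hubbardInteraction L M β 0 = 0 := by
  simp [hubbardInteraction]

/-- **At `U = 0` the effective action vanishes at every scale** (`HubbardEffectiveAction.lean`,
design notes: "at `U = 0`, `Z_Λ = 1` and `𝒢_Λ = 0`"). [folklore] -/
theorem hubbardEffectiveAction_zero_coupling (β μ h Λ : ℝ) : hubbardEffectiveAction L M β 0 μ h Λ = 0 := by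
  rw [hubbardEffectiveAction, hubbardInteraction_zero_coupling, effAction_zero_interaction]

/-- The trivial normal-form data (all functions and pins zero): no self-energy, gap = seed.
[folklore] -/
def HubbardNormalForm.trivial (L Np : ℕ) : HubbardNormalForm L Np :=
  ⟨0, 0, 0, 0, 0, 0, 0, 0, 0, 0⟩

omit [NeZero L] in
/-- The trivial data are parity-even. [folklore] -/
theorem HubbardNormalForm.trivial_isEven : (HubbardNormalForm.trivial L Np).IsEven :=
  fun _ => ⟨rfl, rfl, rfl⟩

/-- The trivial data have zero quadratic form. [folklore] -/
theorem normalFormQuadratic_trivial (β : ℝ) :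
    normalFormQuadratic L M β (HubbardNormalForm.trivial L Np) = 0 := by
  simp [normalFormQuadratic, HubbardNormalForm.trivial]

omit [NeZero L] in
/-- The Cooper vertex of `0` vanishes. [folklore] -/
theorem cooperVertex_zero_right (β : ℝ) (k₁ k₂ k₃ k₄ : FreqMomentum L M) :
    cooperVertex L M β 0 k₁ k₂ k₃ k₄ = 0 := by
  simp [cooperVertex]

/-- The Cooper coefficient of `0` vanishes. [folklore] -/
theorem cooperCoefficient_zero_right (β μ Λ₀ : ℝ) (k₁ k₂ : FreqMomentum L M) :
    cooperCoefficient L M β μ Λ₀ 0 k₁ k₂ = 0 := by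
  simp [cooperCoefficient, cooperVertex_zero_right]

/-- The kept Cooper term of `0` vanishes. [folklore] -/
theorem cooperKept_zero_right (β μ Λ₀ : ℝ) : cooperKept L M β μ Λ₀ (0 : HubbardGrassmann L M) = 0 := by
  simp [cooperKept, cooperCoefficient_zero_right]

/-- **At `U = 0` the trivial data leave no remainder**: `𝒢 = 0`, `𝒬(0) = 0`, `𝒦(0) = 0`. [folklore] -/
theorem remainderOf_free (β μ h Λ₀ : ℝ) :
    remainderOf L M β 0 μ h Λ₀ (HubbardNormalForm.trivial L Np) = 0 := by
  rw [remainderOf, hubbardEffectiveAction_zero_coupling, normalFormQuadratic_trivial, cooperKept_zero_right,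
    sub_zero, sub_zero]

/-- … so the scaled remainder norm of the trivial data is `0` at `U = 0`. [folklore] -/
theorem scaledRemainderNorm_free (β μ h Λ₀ : ℝ) :
    scaledRemainderNorm L M β 0 μ h Λ₀ (HubbardNormalForm.trivial L Np) = 0 := by
  refine Finset.sum_eq_zero fun m _ => ?_
  rw [remainderOf_free,
    show weightedKernel (1 / (β * (L : ℝ) ^ 2)) (0 : HubbardGrassmann L M) m = 0 from
      funext fun X => weightedKernel_zero_right _ m X,
    legKernelNorm_zero_kernel, mul_zero]

/-- The tuple realised by the FREE seeded torus reporting on no patches: the scale-`Λ₀` mean-field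
responses of the free model and zero remainder. [folklore] -/
def freeNoPatchTuple (β μ h Λ₀ : ℝ) : HubbardScaleData.Parameters 0 :=
  ⟨Fin.elim0, scaleStiffness L M β 0 μ h Λ₀, scaleCompressibility L M β 0 μ h Λ₀, 0, 0, 0,
    scaleMeanFieldDensity L M β 0 μ h Λ₀⟩

/-- **Non-vacuity of the normal-form predicate**: at `U = 0`, with no patches, the free seeded torus
realises its mean-field responses with zero remainder, for every `L ≥ 1`, `M`, `β > 0`. (Membership
in the `M → ∞` report additionally needs the convergence of the free Matsubara sums, not done here.)
[folklore] -/
theorem isRealisedAt_free_noPatch {β : ℝ} (hβ : 0 < β) (μ h Λ₀ : ℝ) :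
    IsRealisedAt L M β 0 μ h Λ₀ 0 ∅ (freeNoPatchTuple L M β μ h Λ₀) :=
  ⟨hβ, HubbardNormalForm.trivial L 0, HubbardNormalForm.trivial_isEven L, fun i => i.elim0,
    fun i _ => i.elim0, fun i _ => i.elim0, rfl, rfl, rfl, (scaledRemainderNorm_free L M β μ h Λ₀).le⟩

end Free

section TheReport

variable {Np : ℕ}

/-- **The scale report of the seeded Hubbard torus** for general scale data `(Λ₀, Np, nodal)`:
at `(L, β)` the set of parameter tuples `p` such that for every `δ > 0` and FREQUENTLY in the
Matsubara count `M → ∞` some tuple `δ`-close to `p` is realised at `(L, M, β)` — the Kuratowski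
upper limit in the temporal-continuum parameter `M` of the realised sets (design choice (vi) of the
request: `M → ∞` inside); empty for `L = 0`. [folklore] -/
def hubbardScaleReportAt (U μ h Λ₀ : ℝ) (Np : ℕ) (nodal : Finset (Fin Np)) : HubbardScaleData.Report Np :=
  fun L β =>
    if hL : L = 0 then ∅
    else
      haveI : NeZero L := ⟨hL⟩
      {p | ∀ δ : ℝ, 0 < δ → ∃ᶠ M in atTop, ∃ p' : HubbardScaleData.Parameters Np,
        IsRealisedAt L M β U μ h Λ₀ Np nodal p' ∧ p.IsClose p' δ}

/-- **`hubbardScaleReport U μ D h`** — the model report binding a scale datum `D` to the seeded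
grand-canonical Hubbard torus `dWaveSourceTorus L U μ h` (definition request
`defn-hubbardScaleReport` of route HubbardSuperconductivity/AposterioriCapRg): the report
`hubbardScaleReportAt U μ h D.scale D.numPatches D.nodal` of the Wilsonian effective action
`hubbardEffectiveAction L M β U μ h D.scale` — it depends on `D` only through its scale, its number
of patches and its nodal set, never through its enclosures.  With it the route's cruxes read
`… → D.IsCertifiedEnclosure (hubbardScaleReport U μ D h) L₀ → D.MeetsThresholds K η → …`.
[folklore] -/
def hubbardScaleReport (U μ : ℝ) (D : HubbardScaleData) (h : ℝ) : HubbardScaleData.Report D.numPatches :=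
  hubbardScaleReportAt U μ h (D.scale : ℝ) D.numPatches D.nodal

/-! ### §6 API -/

/-- Unfolding `hubbardScaleReport`: it is the report at the datum's scale, patch number and nodal
set. [folklore] -/
theorem hubbardScaleReport_eq (U μ h : ℝ) (D : HubbardScaleData) :
    hubbardScaleReport U μ D h = hubbardScaleReportAt U μ h (D.scale : ℝ) D.numPatches D.nodal := rfl

/-- Two scale data with the same scale, patch number and nodal set have the same report (the
report never reads the enclosures it is certified against). [folklore] -/
theorem hubbardScaleReport_congr (U μ h : ℝ) {D D' : HubbardScaleData} (hs : D.scale = D'.scale)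
    (hn : D.numPatches = D'.numPatches) (hnod : D.nodal = hn ▸ D'.nodal) :
    hubbardScaleReport U μ D h = hn ▸ hubbardScaleReport U μ D' h := by
  cases D; cases D'; cases hn; cases hs; cases hnod; rfl

/-- On the degenerate torus `L = 0` the report is empty. [folklore] -/
@[simp] theorem hubbardScaleReportAt_zero_length (U μ h Λ₀ : ℝ) (nodal : Finset (Fin Np)) (β : ℝ) :
    hubbardScaleReportAt U μ h Λ₀ Np nodal 0 β = ∅ := dif_pos rfl

/-- Membership in the report for `L ≥ 1`. [folklore] -/
theorem mem_hubbardScaleReportAt_iff (U μ h Λ₀ : ℝ) (nodal : Finset (Fin Np)) (L : ℕ) [NeZero L] (β : ℝ)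
    (p : HubbardScaleData.Parameters Np) :
    p ∈ hubbardScaleReportAt U μ h Λ₀ Np nodal L β ↔
      ∀ δ : ℝ, 0 < δ → ∃ᶠ M in atTop, ∃ p' : HubbardScaleData.Parameters Np,
        IsRealisedAt L M β U μ h Λ₀ Np nodal p' ∧ p.IsClose p' δ := by
  simp only [hubbardScaleReportAt, dif_neg (NeZero.ne L)]
  rfl

/-- A tuple realised for all large `M` is reported (the simplest way into the upper limit).
[folklore] -/
theorem mem_hubbardScaleReportAt_of_eventually {U μ h Λ₀ : ℝ} {nodal : Finset (Fin Np)} {L : ℕ} [NeZero L]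
    {β : ℝ} {p : HubbardScaleData.Parameters Np}
    (hp : ∀ᶠ M in atTop, IsRealisedAt L M β U μ h Λ₀ Np nodal p) :
    p ∈ hubbardScaleReportAt U μ h Λ₀ Np nodal L β := by
  rw [mem_hubbardScaleReportAt_iff]
  intro δ hδ
  exact (hp.mono fun M hM => ⟨p, hM, HubbardScaleData.Parameters.isClose_self p hδ⟩).frequently

/-- **Reported tuples have a nonnegative remainder norm** (`Λ₀ ≥ 0`): the report is a proper
subset of the parameter space. [folklore] -/
theorem remainderNorm_nonneg_of_mem {U μ h Λ₀ : ℝ} (hΛ : 0 ≤ Λ₀) {nodal : Finset (Fin Np)} {L : ℕ} {β : ℝ}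
    {p : HubbardScaleData.Parameters Np} (hp : p ∈ hubbardScaleReportAt U μ h Λ₀ Np nodal L β) :
    0 ≤ p.remainderNorm := by
  rcases Nat.eq_zero_or_pos L with rfl | hL
  · simp at hp
  · haveI : NeZero L := NeZero.of_pos hL
    rw [mem_hubbardScaleReportAt_iff] at hp
    refine le_of_forall_pos_lt_add fun δ hδ => ?_
    obtain ⟨M, p', hp', hclose⟩ := (hp δ hδ).exists
    have h1 := hp'.remainderNorm_nonneg hΛ
    have h2 := hclose.2.2.2.2.2.1
    rw [abs_lt] at h2
    linarith

/-- **The report is not the universal report**: e.g. no tuple with negative remainder norm is ever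
reported (answering the refuters' probe that `fun _ _ => Set.univ` would certify every datum).
[folklore] -/
theorem hubbardScaleReport_ne_univ (U μ h : ℝ) (D : HubbardScaleData) (L : ℕ) (β : ℝ) :
    hubbardScaleReport U μ D h L β ≠ Set.univ := by
  intro huniv
  have hmem : (⟨fun _ => 0, 0, 0, 0, 0, -1, 0⟩ : HubbardScaleData.Parameters D.numPatches) ∈
      hubbardScaleReport U μ D h L β := by
    rw [huniv]; exact Set.mem_univ _
  have := remainderNorm_nonneg_of_mem (by exact_mod_cast D.scale_pos.le) hmem
  norm_num at this

/-- A datum whose remainder enclosure lies below `0` is never a certified enclosure of the report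
(its enclosures would have to contain a reported, hence nonnegative, remainder norm). [folklore] -/
theorem not_isCertifiedEnclosure_of_remainderNorm_snd_neg (U μ h : ℝ) (D : HubbardScaleData)
    (hD : D.remainderNorm.snd < 0) (L₀ : ℕ) :
    ¬ D.IsCertifiedEnclosure (hubbardScaleReport U μ D h) L₀ := by
  intro hcert
  obtain ⟨β₀, hβ₀⟩ := hcert L₀ le_rfl
  obtain ⟨p, hp, henc⟩ := hβ₀ β₀ le_rfl
  have h0 := remainderNorm_nonneg_of_mem (by exact_mod_cast D.scale_pos.le) hp
  obtain ⟨-, -, -, -, -, hη, -⟩ := henc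
  rw [NonemptyInterval.mem_ratCast_iff] at hη
  have : (D.remainderNorm.snd : ℝ) < 0 := by exact_mod_cast hD
  linarith [hη.2]

end TheReport

end Literature.MathematicalPhysics.QuantumLattice
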